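import Summits.BirchSwinnertonDyer.Rank1Residual.O5.O5LocalLattice
import HarnessLib

/-!
# T33 (cont.) — LEMMA B bookkeeping, the half-Hasse profile and the reducible RAMP law L5′ of the local point lattice of an
# O5b curve along `ℚ₃(μ_{3^∞})` (EVIDENCE-labelled; typed for cc-typer-5, ask A-O5-37 of o5-r1 GEN 16)
(cell `b2b-bsdres`, lane CLASS-CLOSURE, team o5, planner o5-r1 GEN 16; memo `HOME/b2b-bsdres-o5-r1/gen16/T33-LOCAL-POINT-LATTICE.md`
 §3 L5′, §3′ Rider ES, §3″ LEMMA A/B, §7 FINAL; kit j145657 `t33-loclat` / j146861 `t33-kob5` / j147616 `t33-hh5`; pre-registrations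
 `gen16/t33/PREREG-T33.md` + `PREREG-T33-ADDENDUM.md` e85a52d7 (E1, P3-red), `PREREG-KOB5.md` 040e6e2b, `PREREG-HH5.md` e7f8f7aa; planner's
 shell `gen16/T33LocalLattice.lean` (26 decls) — this file places its decls 17–26 (+ the LEMMA B rule) next to `O5/O5LocalLattice.lean`
 (cc-typer-5 GEN 11, decls 1–16 + the interface and laws L1–L4, L7), which stays byte-identical; typer of record cc-typer-5 GEN 12.
 NOTHING about curves is asserted; no Literature fact is introduced.)

HONEST FRAMING (cell `b2b-bsdres`, verbatim in every file): the goal of the cell is to DELETE the COMBINATION-SHAPED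
residual classes of the Birch–Swinnerton-Dyer formula for ALL analytic-rank `≤ 1` elliptic curves over `ℚ` — "full BSD
formula for every rank `≤ 1` curve in class `C`" assembled STRICTLY from published theorems — so that the rank-`≤ 1`
remainder becomes exactly the CONSTRUCTION-SHAPED classes, which are TYPED (missing-input `Prop`s), NOT attempted.
Lane CLASS-CLOSURE: census output is EVIDENCE / conjecture items with held-out validation, never a Literature fact.

WHAT THIS FILE TYPES (vocabulary of `O5/O5LocalLattice.lean`: `kobQplus`/`kobQminus` = `Q⁺/Q⁻`, `twistShift` = `T(m, ε)`, `totientThreePow`,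
the interface `LocalLatticeDatum W` with `posCap`/`posPr` and the realisation variable `realL`, the nodes L1–L4, L7, D1-fin-pos).
* §1′ LEMMA B bookkeeping (memo §3″): the RULE `ballTop j ε` for the two top positions of the PURE cyclotomic ball `π_n^{−j}·O_{k_n}`
  (`pos₊ + pos₋ = −⌈2j/3⌉`, the odd step on `−` iff `j ≡ 1 (6)`, on `+` iff `j ≡ 4 (6)`; verified 80/80 + `j_4` by `t33/ball_pos.py`) and the
  PROVED identity `ballTop_half_eq_twistShift`: at the half-index `j_n = (3^n − 1)/2` the rule IS the twist vector `T(n, ε)` for EVERY `n ≥ 1`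
  (planner's draft: `n ≤ 8` by `decide`) — with LEMMA A (`e_top L_n(W) = e_top π_n^{−j_n}O_{k_n}`) the class-blind top law L3 is cyclotomic
  bookkeeping (memo §3″ PROOF OUTLINE B1–B3 is the o5 cell's GEN-17 write-up; nothing of it is asserted here).
* §1″ the HALF-HASSE closed profile `hhRamp n m = −3^{m−1}(n − m)`, `hhCap m = (3^{m−1}+1)/2`, `hhBottom` (memo §3′ Rider ES: the plain
  log-lattice of ANY good supersingular curve over `O_F = ℤ₃[√−3]` with `v_F(Ha) = 1`; a period-ONE half-step ramp against Kobayashi's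
  period-two staircase for `v_F(Ha) ≥ 2`), the reducible RAMP law value `rampRed` (L5′ written out) and the PROVED identities
  `hhCap_eq_neg_min_twistShift` (ALL `m ≥ 1`), **`rampRed_eq_hhRamp_add_twistShift_flip` (L5′ ≡ HH + `T` with the parity FLIPPED at odd
  distance from the top, ALL `1 ≤ m ≤ n`; draft `n, m ≤ 7`)**, `rampRed_self` (top level = L3's value); the pre-registered `n = 5` numbers
  as VALUES of these functions: `rampRed_values` (P3-red), `hhPrereg5_values` (PREREG-HH5's 24 numbers), `irrFive_eq_kob_add_twistShift`
  (P3-irr = Kobayashi's `n = 5` line read at the opposite sign + `T`, i.e. L7 at `n = 5`).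
* §3′ the REDUCIBLE class as an `@[conjecture]` EVIDENCE node over `realL`: **`HalfHasseTransportLawThree`** (L5′/HH; the reducible-side
  analogue of L4 + L7: pr = `rampRed` for `1 ≤ m ≤ n`, caps = own-level caps, bottoms split ↦ the irr bottoms of L4 / nonsplit ↦ `hhBottom`;
  a COMPARISON statement read against the CLOSED half-Hasse profile because the comparison curves live over `ℤ₃[√−3]`, where D-T33-1 has no
  datum), with the PROVED `posPr_eq_hhRamp_add_twistShift` (transport form), `topProjection_of_halfHasse` (L5′ ⇒ L3 on reducible rows),
  **`topProjectionLaw_of_classLaws` (D1-fin-pos ∧ L5′ ⇒ `TopProjectionLawThree` on EVERY O5b row: the class-blind top law is a corollary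
  of the two class laws)**, and the record `redProfile_matches_table` (L5′ + bottoms ⇔ the memo's exact `n ≤ 4` tables of `9702g1` / `90a1`).
EVIDENCE (memo §7 FINAL; exact 3-adic arithmetic, ONE implementation per object ⇒ EVIDENCE label only). Kit j145657 (ended
2026-08-22T03:18:16Z, 563 records): P1 class-only dependence 132/132 rows × `n ≤ 3`, P2 30/30 at `n = 4`, P4/P5/!CAL clean, **P3 (`n = 5`,
every value a prediction) 5/5 rows exact on 114/114 numbers** (irr ×3 = L7 ∘ Kobayashi; reducible ×2 = L5′ incl. bottoms and caps; top
`−40/−41` ×5 = LEMMA A + B at a new level); kit j146861 (PREREG-KOB5: good-ss `y² = x³ − x` at `n = 5`) 12/12; kit j147616 (PREREG-HH5: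
half-Hasse model V1 at `n = 5`) 24/24 + tors 0 (census READ VALID + reproduced, HOME INBOX l.8984). Typer's re-read of
`gen16/t33/j145657_table.txt` for L5′ on the 88 reducible rows: 1236/1236 pr values (`n ≤ 5`), 572/572 bottoms, 664/664 cap constancies,
0 deviations (breakdown at the node). Falsifier of the node: one realised reducible row violating a displayed equation.
References: [Kobayashi2003] §8; [Pollack2003]; [Kurihara2002]; [KKS2018] arXiv:1808.07726 §2 Thm 2.1 / Cor 2.4 (image of `log` on `Ê(𝔪_K)`,
UNRAMIFIED `K`, split class excluded) [corpus: paper-arxiv-1808.07726 p0005–p0007]; [LeiPollackPratap2024] arXiv:2412.16629 §4.3;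
[corpus: silverman2009-arithmetic-elliptic-curves-2nd-ed p.135] (AEC Thm V.4.1(a): the Hasse invariant of `y² = f(x)` at `p = 3` is the
`x²`-coefficient). Presearch (planner memo §6 + Rider ES line; typer 2026-08-22, corpus hybrid / vsearch "formal group logarithm supersingular
elliptic curve ramified extension Hasse invariant valuation image of points" → textbook pages only [corpus: silverman2009 p.138, silverman1994
p.513, delbourgo2008 p.23]; galaxy pdf needles "Pannekoek|…", "canonical subgroup|…" → none relevant): a signed / period-one lattice law
for `v(Ha) = e/2` over a RAMIFIED base is NOT IN PRINT as far as searched.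
-/

set_option autoImplicit false

open WeierstrassCurve Literature.NumberTheory.EllipticCurves Summit.BirchSwinnertonDyer.Rank1Residual.Additive

namespace Summit.BirchSwinnertonDyer.Rank1Residual.O5

/-! ### §1′ LEMMA B bookkeeping: the top positions of the cyclotomic ball (memo §3″; A-O5-37) -/

/-- LEMMA B bookkeeping (memo §3″; the RULE read off the full scans `t33/ball_scan_n2.log` / `ball_scan_n3.log` — 80/80 values
`0 ≤ j < e` for `n ≤ 3` — and at `j = (3^4 − 1)/2` for `n = 4`; EVIDENCE for the lattice statement, exact arithmetic here): the two top
positions of the PURE cyclotomic ball `π_n^{−j}·O_{k_n}` (no curve) satisfy `pos₊ + pos₋ = −⌈2j/3⌉`; `ballTopSum j` is that sum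
(`⌈2j/3⌉ = ⌊(2j + 2)/3⌋`, an exact natural-number division). -/
def ballTopSum (j : ℕ) : ℤ := -(((2 * j + 2) / 3 : ℕ) : ℤ)

/-- The rule for the individual top positions of `π_n^{−j}·O_{k_n}`: the two parities share `ballTopSum j` equally unless `j ≡ 1 (mod 6)`
(the odd step falls on `ε = −`) or `j ≡ 4 (mod 6)` (on `ε = +`); all divisions below are exact. Memo §3″ PROOF OUTLINE B1–B3 (for the o5
cell's GEN 17, a write-up not a search): the valuation filtration `A₊ = {0, 4}`, `A₋ = {1, 3} (mod 6)` of the `(σ₄ − 1)`-orbit and the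
monomial projections via the different of `k_n/k_{n−1}` (`3·e_n = 3 − Tr`). `true` = the `σ₋₁`-even parity. -/
def ballTop (j : ℕ) (even : Bool) : ℤ :=
  if j % 6 = 1 then (if even then (ballTopSum j + 1) / 2 else (ballTopSum j - 1) / 2)
  else if j % 6 = 4 then (if even then (ballTopSum j - 1) / 2 else (ballTopSum j + 1) / 2)
  else ballTopSum j / 2

/-- The rule's values at `j = 0, 1, 2, 3, 4, 5, 13, 40` (`13 = (3^3−1)/2`, `40 = (3^4−1)/2`: `−4/−5`, `−14/−13` = `T(3,±)`, `T(4,±)`). -/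
theorem ballTop_values :
    (List.map (fun j => (ballTop j true, ballTop j false)) [0, 1, 2, 3, 4, 5, 13, 40] =
      [(0, 0), (0, -1), (-1, -1), (-1, -1), (-2, -1), (-2, -2), (-4, -5), (-14, -13)]) := by
  decide

/-- `ballTopSum` at a half-index `j = (3a − 1)/2` (`a` odd) is `−a`: `⌈2j/3⌉ = ⌈(3a − 1)/3⌉ = a`. -/
theorem ballTopSum_half (a : ℕ) (ha : a % 2 = 1) : ballTopSum ((3 * a - 1) / 2) = -(a : ℤ) := by
  unfold ballTopSum
  have h : (2 * ((3 * a - 1) / 2) + 2) / 3 = a := by omega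
  rw [h]

/-- **LEMMA B's rule at the half-index `j_n = (3^n − 1)/2` IS the twist vector, for EVERY `n ≥ 1`** (planner's draft: `n ≤ 8` by `decide`):
`ballTop ((3^n − 1)/2) ε = T(n, ε)` — because `j_n ≡ 1 / 4 (mod 6)` for `n` odd / even and `⌈2j_n/3⌉ = 3^{n−1}`. With LEMMA A
(`e_top L_n(W) = e_top π_n^{−j_n}O_{k_n}`, memo §3″) this is the class-blind top law L3 as cyclotomic bookkeeping. -/
theorem ballTop_half_eq_twistShift (n : ℕ) (hn : 1 ≤ n) (ε : Bool) :
    ballTop ((3 ^ n - 1) / 2) ε = twistShift n ε := by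
  obtain ⟨k, rfl⟩ : ∃ k, n = k + 1 := ⟨n - 1, by omega⟩
  have hc := kobQ_closed_form (k + 1) hn
  simp only [Nat.add_sub_cancel] at hc
  have h4 := three_pow_mod_four k
  have hpow : (3 : ℕ) ^ (k + 1) = 3 * 3 ^ k := by rw [pow_succ]; ring
  have hcast : ((3 : ℤ) ^ k) = ((3 ^ k : ℕ) : ℤ) := by push_cast; rfl
  rw [hcast] at hc
  generalize 3 ^ k = a at hc h4 hpow
  rw [hpow]
  have h0 : k + 1 ≠ 0 := by omega
  rcases Nat.even_or_odd k with ⟨i, hi⟩ | ⟨i, hi⟩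
  · have h1 : (-1 : ℤ) ^ (k + 1) = -1 := Odd.neg_one_pow ⟨i, by omega⟩
    rw [h1] at hc
    rw [if_pos (by omega)] at h4
    have hj : (3 * a - 1) / 2 % 6 = 1 := by omega
    have hs := ballTopSum_half a (by omega)
    unfold ballTop
    rw [if_pos hj, hs]
    cases ε <;> simp only [twistShift, h0, if_false, if_true, Bool.false_eq_true] <;> omega
  · have h1 : (-1 : ℤ) ^ (k + 1) = 1 := Even.neg_one_pow ⟨i + 1, by omega⟩
    rw [h1] at hc
    rw [if_neg (by omega)] at h4
    have hj : (3 * a - 1) / 2 % 6 = 4 := by omega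
    have hs := ballTopSum_half a (by omega)
    unfold ballTop
    rw [if_neg (by omega), if_pos hj, hs]
    cases ε <;> simp only [twistShift, h0, if_false, if_true, Bool.false_eq_true] <;> omega

/-! ### §1″ The half-Hasse profile and the reducible RAMP law L5′ (memo §3′ Rider ES, ADDENDUM P3-red; A-O5-37) -/

/-- **HALF-HASSE MODEL LAW HH — the projection ramp** (memo §3′ Rider ES; EVIDENCE, ONE implementation `gen16/t33/es_calib.py`): the PLAIN
log-lattice `log_E(Ê(𝔪_{k_n})) ⊂ k_n` of ANY good supersingular curve `E` over `O_F = ℤ₃[√−3]` whose Hasse invariant has `v_F(Ha) = 1`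
(= `e/2`: canonical subgroup of level one, no tower) has `pr^{(n)}(m, ±) = −3^{m−1}(n − m)` for `1 ≤ m ≤ n` — a LINEAR half-step ramp,
one half-period per level, where the curves with `v_F(Ha) ≥ 2` (all `ℤ₃`-curves; model curves with `v_F(Ha) ∈ {2, 3, 5}` checked) show
Kobayashi's STAIRCASE `−φ(3^m)⌊(n − m)/2⌋`. Seven model curves (two NOT of the twisted-model shape) give ONE profile for `n ≤ 3`
(moduli-blind); `n = 4` predicted before the run (seat notes 02:50Z) and hit 21/21 on V1 (V6 identical); `n = 5` PRE-REGISTERED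
(`t33/PREREG-HH5.md` e7f8f7aa, frozen before kit j147616 was submitted) and HIT 24/24 + tors 0 (census-reproduced, HOME INBOX l.8984).
The twisted models `A : y² = x³ − r s x² + a₄ x + a₆ s` (`s = √−3`) of the REDUCIBLE O5b rows are exactly such curves (`Ha = a₂ = −r s`,
`3 ∤ r`; irr ⟺ `v_F(Ha) ≥ 3`) — memo §2 / §3′. Nothing about curves is asserted by this `def`; it is the closed form the evidence fits. -/
def hhRamp (n m : ℕ) : ℤ := -(((3 ^ (m - 1) : ℕ) : ℤ) * ((n : ℤ) - m))

/-- HH caps: `(3^{m−1} + 1)/2 = 1, 2, 5, 14, 41, …`, independent of the tower level `n` (memo §3′ Rider ES (b)). -/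
def hhCap (m : ℕ) : ℤ := (((3 ^ (m - 1) + 1) / 2 : ℕ) : ℤ)

/-- The half-Hasse caps are the absolute value of the deeper of the two twist positions: `(3^{m−1} + 1)/2 = −min(T(m,+), T(m,−))`, for
EVERY `m ≥ 1` (planner's draft: `m ≤ 8` by `decide`; from `twistShift_sum_diff`). -/
theorem hhCap_eq_neg_min_twistShift (m : ℕ) (hm : 1 ≤ m) :
    hhCap m = -min (twistShift m true) (twistShift m false) := by
  have h := twistShift_sum_diff m hm
  have hodd : (3 : ℕ) ^ (m - 1) % 2 = 1 := by
    rw [Nat.pow_mod]; norm_num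
  unfold hhCap
  rcases Nat.even_or_odd m with ⟨i, hi⟩ | ⟨i, hi⟩
  · have h1 : (-1 : ℤ) ^ m = 1 := Even.neg_one_pow ⟨i, hi⟩
    rw [h1] at h
    rw [min_eq_left (by omega)]
    push_cast; omega
  · have h1 : (-1 : ℤ) ^ m = -1 := Odd.neg_one_pow ⟨i, hi⟩
    rw [h1] at h
    rw [min_eq_right (by omega)]
    push_cast; omega

/-- HH values: the ramp at `n = 4` (`−3, −6, −9, 0`) and `n = 3` (`−2, −3, 0`), caps `1, 2, 5, 14` (the `n = 4` line hit 21/21). -/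
theorem hhRamp_values :
    List.map (fun m => hhRamp 4 m) [1, 2, 3, 4] = [-3, -6, -9, 0] ∧ List.map (fun m => hhRamp 3 m) [1, 2, 3] = [-2, -3, 0] ∧
    List.map hhCap [1, 2, 3, 4] = [1, 2, 5, 14] := by
  decide

/-- HH bottoms: `(0,+) = −⌊(n−1)/2⌋`, `(0,−) = −⌊n/2⌋` (memo §3′ Rider ES (b); EVIDENCE `n ≤ 4`, pre-registered and hit at `n = 5`). On O5b
rows this is ALSO the bottom law of the NONSPLIT reducible class, while the SPLIT class has the irr bottoms `−⌊n/2⌋ / −⌈n/2⌉` of L4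
(ADDENDUM P3-red; typer's re-read of `j145657_table.txt`: 34 nonsplit + 54 split rows, `n ≤ 5`, 572/572 — see `HalfHasseTransportLawThree`). -/
def hhBottom (n : ℕ) (even : Bool) : ℤ := if even then -(((n - 1) / 2 : ℕ) : ℤ) else -((n / 2 : ℕ) : ℤ)

/-- **L5′ — the reducible RAMP law, written out** (memo §3 L5′; `t33/PREREG-T33-ADDENDUM.md` e85a52d7 P3-red):
`pr^{(n)}(m, ε) = T(m, ε) − 3^{m−1}(n − m) + ε·(−1)^{n+1}·[n − m odd]` (`1 ≤ m ≤ n`; `ε = true ↦ +1`) — valuation loss exactly ½ per level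
descended plus a one-step parity wobble, the SAME values on both reducible classes (split and nonsplit), against the irr / good-ss STAIRCASE
of L4. `rampRed_eq_hhRamp_add_twistShift_flip`: **L5′ ≡ HH + the twist vector `T` with the parity FLIPPED at odd distance from the top** —
the reducible class is a transport too (onto the half-Hasse model), exactly as L7 transports the irr class onto Kobayashi's lattice (memo §3′
Rider ES (d); (e′): for ONE curve the O5b split profile and HH are the τ-odd / τ-even parts of the log-lattice of one formal group over `O_{K_n}`). -/
def rampRed (n m : ℕ) (even : Bool) : ℤ :=
  twistShift m even + hhRamp n m + (if (n - m) % 2 = 1 then (if even then (1 : ℤ) else -1) * (-1) ^ (n + 1) else 0)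

/-- L5′ values: the `n = 4` line of the reducible reference rows `90a1` (split) / `9702g1` (nonsplit), `(1..4, ±)` = `−4/−3, −8/−7, −14/−13,
−14/−13`, and the P3-red PREDICTION for `n = 5`, `(1..5, ±)` = `−4/−5, −10/−11, −22/−23, −40/−41, −40/−41` — observed on 2/2 rows by kit
j145657 plan C (first `n = 5` record 56 min after the ADDENDUM was written). -/
theorem rampRed_values :
    List.map (fun p : ℕ × Bool => rampRed 4 p.1 p.2)
      [(1, true), (1, false), (2, true), (2, false), (3, true), (3, false), (4, true), (4, false)] = [-4, -3, -8, -7, -14, -13, -14, -13] ∧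
    List.map (fun p : ℕ × Bool => rampRed 5 p.1 p.2)
      [(1, true), (1, false), (2, true), (2, false), (3, true), (3, false), (4, true), (4, false), (5, true), (5, false)] =
      [-4, -5, -10, -11, -22, -23, -40, -41, -40, -41] := by
  decide

/-- **L5′ ≡ HH + flipped `T`**, for ALL `1 ≤ m ≤ n` (planner's draft: `n, m ≤ 7` by `decide`): at odd distance `n − m` from the top the wobble
`ε(−1)^{n+1} = ε(−1)^m` exchanges `T(m, +)` and `T(m, −)` (`T(m,+) − T(m,−) = −(−1)^m`, `twistShift_sum_diff`). Not valid at `m = 0`. -/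
theorem rampRed_eq_hhRamp_add_twistShift_flip (n m : ℕ) (hm : 1 ≤ m) (hmn : m ≤ n) (e : Bool) :
    rampRed n m e = hhRamp n m + twistShift m (if (n - m) % 2 = 1 then !e else e) := by
  have h := (twistShift_sum_diff m hm).2
  unfold rampRed
  by_cases hpar : (n - m) % 2 = 1
  · rw [if_pos hpar, if_pos hpar]
    have hn1 : (-1 : ℤ) ^ (n + 1) = (-1) ^ m := by
      rcases Nat.even_or_odd m with ⟨i, hi⟩ | ⟨i, hi⟩
      · rw [Even.neg_one_pow ⟨i, hi⟩, Even.neg_one_pow ⟨i + (n - m + 1) / 2, by omega⟩]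
      · rw [Odd.neg_one_pow ⟨i, hi⟩, Odd.neg_one_pow ⟨i + (n - m + 1) / 2, by omega⟩]
    rw [hn1]
    cases e with
    | false => simp only [Bool.false_eq_true, if_false, Bool.not_false]; linear_combination (-1 : ℤ) * h
    | true => simp only [if_true, Bool.not_true]; linear_combination h
  · rw [if_neg hpar, if_neg hpar]; ring

/-- At the top level the ramp value IS the class-blind top law: `rampRed n n ε = T(n, ε)` ('the top two levels coincide' on reducible rows
is `rampRed n (n−1) ε = rampRed n n ε`, e.g. `−40/−41` twice at `n = 5`). -/
theorem rampRed_self (n : ℕ) (e : Bool) : rampRed n n e = twistShift n e := by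
  simp [rampRed, hhRamp]

/-- PREREG-HH5 (`t33/PREREG-HH5.md` e7f8f7aa, frozen 2026-08-22T02:56:03Z BEFORE kit job j147616 `t33-hh5` was submitted; the half-Hasse
model `V1 : y² = x³ + s x² + x` over `ℤ₃[√−3]` at `n = 5`, `e = 486`): the 24 pre-registered numbers are exactly the values of `hhCap`,
`hhRamp 5`, `hhBottom 5` below (caps / pr for `m = 1..5`: `1/−4, 2/−9, 5/−18, 14/−27, 41/0` on both signs; bottom pr `−2 / −2` with caps
`1/0`). OBSERVED (job ended 03:24:07Z, exit 0): identical, 24/24 + tors 0 — memo §7; census READ VALID + reproduced (HOME INBOX l.8984). -/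
theorem hhPrereg5_values :
    List.map (fun m => (hhCap m, hhRamp 5 m)) [1, 2, 3, 4, 5] = [(1, -4), (2, -9), (5, -18), (14, -27), (41, 0)] ∧
    (hhBottom 5 true, hhBottom 5 false) = (-2, -2) ∧ (hhBottom 4 true, hhBottom 4 false) = (-1, -2) := by
  decide

/-- P3 of PREREG-T33 (+ ADDENDUM E1) versus kit j145657 plan C (`n = 5`; irr rows `2205c1`, `3150f1`, `7650d1`, identical 24-number
profiles): the observed irr projections `pr^{(5)}(m, ±)`, `m = 1..5` = `−4/−5, −8/−7, −22/−23, −14/−13, −40/−41`, ARE the Kobayashi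
`n = 5` projections (`−4/−4, −6/−6, −18/−18, 0/0, 0/0`; PREREG-KOB5, kit j146861 12/12 on `y² = x³ − x`) read at the opposite sign plus
`twistShift` — L7 at its first filed out-of-sample level, recorded here only as the arithmetic identity between the filed numbers. -/
theorem irrFive_eq_kob_add_twistShift :
    List.map (fun p : ℤ × ℕ × Bool => p.1 + twistShift p.2.1 p.2.2)
      [(-4, 1, true), (-4, 1, false), (-6, 2, true), (-6, 2, false), (-18, 3, true), (-18, 3, false), (0, 4, true), (0, 4, false),
       (0, 5, true), (0, 5, false)] = [-4, -5, -8, -7, -22, -23, -14, -13, -40, -41] := by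
  decide

/-! ### §3′ The reducible class as a node: L5′ / half-Hasse transport (A-O5-37; the reducible-side analogue of L4 + L7) -/

variable (realL : ∀ (W : WeierstrassCurve ℚ) [W.IsElliptic] [W.IsGloballyMinimal], LocalLatticeDatum W → Prop)

/-- **L5′ / HH — RAMP = HALF-HASSE TRANSPORT LAW (reducible O5b rows; conjecture, EVIDENCE; a COMPARISON statement read against the
CLOSED half-Hasse profile).** On an O5b curve `W` (`ClassO5 W 3 ∧ SubTprime W 3`) with `W[3]|G_{ℚ₃}` reducible (`¬ LocIrr W 3`; 88/132
rows: split 54 = `¬ NoLocalThreeTorsionAt W 3`, nonsplit 34), at every tower level `n ≥ 1`: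
(i) every projection at component level `1 ≤ m ≤ n` is the ramp value, `posPr n m ε = rampRed n m ε` (= `hhRamp n m + T(m, ε·(−1)^{n−m})`
by `rampRed_eq_hhRamp_add_twistShift_flip`: the half-Hasse MODEL profile — the plain log-lattice of any good-ss `E/ℤ₃[√−3]` with
`v_F(Ha) = 1` — transported by the twist vector of L7 with the parity flipped at odd distance from the top), and caps do not move below
their own level, `posCap n m ε = posCap m m ε` (the top caps themselves are L2 `BoundedCapLawThree`);
(ii) bottoms: SPLIT rows have the irr bottoms of L4, `−⌊n/2⌋ / −⌈n/2⌉`; NONSPLIT rows have the half-Hasse bottoms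
`hhBottom n ε = −⌊(n−1)/2⌋ / −⌊n/2⌋`.
WHY AGAINST A CLOSED PROFILE and not a second datum (as L7 does with `E₀/ℚ`): the comparison curves live over `O_F = ℤ₃[√−3]`, for which
the tree has no `LocalLatticeDatum` (D-T33-1 is an interface for curves over `ℚ`, §2); their profile is moduli-blind and pre-registered-exact
(`hhRamp` / `hhCap` / `hhBottom`; kit j147616 24/24), so the node quotes it in closed form.
`-- TODO(general form): the lattice-level statement (memo §3′ (e′): L_n(W) and the HH lattice are the τ-odd / τ-even parts of the`
`-- log-lattice of ONE formal group over O_{K_n}; GEN-17 agenda items 3–4) needs D-T33-1 over O_F.`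
EVIDENCE (statement-discovery; ONE implementation `gen16/t33/loclat.py` 0632f5d2, kit j145657 FINAL 2026-08-22T03:18Z; typer's re-read of
`HOME/b2b-bsdres-o5-r1/gen16/t33/j145657_table.txt`, 563 records / 132 rows): on all 88 reducible rows every pr value with `1 ≤ m ≤ n`
equals `rampRed n m ε` — `n = 1`: 176/176, `n = 2`: 352/352, `n = 3`: 528/528 (88 rows each), `n = 4`: 160/160 (20 plan-B rows),
`n = 5`: 20/20 (`90a1` split, `9702g1` nonsplit) = 1236/1236; bottoms (ii) 572/572; cap constancy 664/664; 0 deviations. Only the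
`n = 5` values are PREDICTIONS (P3-red: `t33/PREREG-T33-ADDENDUM.md` e85a52d7 written 02:01:22Z, first `n = 5` record 02:57:44Z): pr,
bottoms and caps all hit on 2/2 rows; `n ≤ 4` is the data the law was read from (reference rows) under the pre-registered class-constancy
P1 (132/132 × `n ≤ 3`) / P2 (30/30, `n = 4`). HH model side: kit j147616 (V1, `n = 5`) HIT 24/24. Falsifier: one realised reducible row
violating (i) or (ii). Presearch (planner memo §6 + rider; typer 2026-08-22: corpus hybrid / vsearch "formal group logarithm supersingular …
ramified … Hasse invariant" → textbook pages only [corpus: silverman2009 p.138, silverman1994 p.513, delbourgo2008 p.23]; galaxy pdf needles →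
none relevant): a period-ONE ramp law for `v(Ha) = e/2` over a RAMIFIED base is NOT IN PRINT as far as searched ([KKS2018] arXiv:1808.07726 §2
treats unramified bases and excludes the split class). [folklore] -/
@[conjecture] def HalfHasseTransportLawThree : Prop :=
  ∀ (W : WeierstrassCurve ℚ) [W.IsElliptic] [W.IsGloballyMinimal] (L : LocalLatticeDatum W),
    ClassO5 W 3 → SubTprime W 3 → ¬ LocIrr W 3 → realL W L → ∀ n, 1 ≤ n →
      (∀ m ε, 1 ≤ m → m ≤ n → L.posPr n m ε = rampRed n m ε ∧ L.posCap n m ε = L.posCap m m ε) ∧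
      (¬ NoLocalThreeTorsionAt W 3 → L.posPr n 0 true = -((n / 2 : ℕ) : ℤ) ∧ L.posPr n 0 false = -(((n + 1) / 2 : ℕ) : ℤ)) ∧
      (NoLocalThreeTorsionAt W 3 → L.posPr n 0 true = hhBottom n true ∧ L.posPr n 0 false = hhBottom n false)

variable {realL}

/-- The TRANSPORT form of (i): under L5′ every reducible projection is the half-Hasse ramp plus the flipped twist vector
(`1 ≤ m ≤ n`). [folklore] -/
theorem posPr_eq_hhRamp_add_twistShift (h5 : HalfHasseTransportLawThree realL) {W : WeierstrassCurve ℚ} [W.IsElliptic]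
    [W.IsGloballyMinimal] {L : LocalLatticeDatum W} (hO : ClassO5 W 3) (hT : SubTprime W 3) (hR : ¬ LocIrr W 3) (hL : realL W L)
    {n m : ℕ} (hm : 1 ≤ m) (hmn : m ≤ n) (ε : Bool) :
    L.posPr n m ε = hhRamp n m + twistShift m (if (n - m) % 2 = 1 then !ε else ε) := by
  rw [((h5 W L hO hT hR hL n (hm.trans hmn)).1 m ε hm hmn).1, rampRed_eq_hhRamp_add_twistShift_flip n m hm hmn ε]

/-- L5′ ⇒ L3 on the reducible rows: at the top level the ramp value is the class-blind top law (`rampRed_self`). [folklore] -/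
theorem topProjection_of_halfHasse (h5 : HalfHasseTransportLawThree realL) {W : WeierstrassCurve ℚ} [W.IsElliptic]
    [W.IsGloballyMinimal] {L : LocalLatticeDatum W} (hO : ClassO5 W 3) (hT : SubTprime W 3) (hR : ¬ LocIrr W 3) (hL : realL W L)
    {n : ℕ} (hn : 1 ≤ n) (ε : Bool) : L.posPr n n ε = twistShift n ε := by
  rw [((h5 W L hO hT hR hL n hn).1 n ε hn le_rfl).1, rampRed_self]

/-- **The class-blind top law is a COROLLARY of the two class laws**: D1-fin (position form) on the irr rows and L5′ on the reducible
rows together give L3 `TopProjectionLawThree` on EVERY O5b row (memo §3″: and L3 is LEMMA A + LEMMA B). [folklore] -/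
theorem topProjectionLaw_of_classLaws (hD : DOneFinPositionLawThree realL) (h5 : HalfHasseTransportLawThree realL) :
    TopProjectionLawThree realL := by
  intro W _ _ L hO hT hL n hn ε
  by_cases hI : LocIrr W 3
  · exact (hD W L hO hT hI hL n hn).2.1 ε
  · exact topProjection_of_halfHasse h5 hO hT hI hL hn ε

/-- **RECORD (EVIDENCE ⇔ L5′ at `n ≤ 4`).** `rampRed` and the two bottom laws reproduce the memo's exact tables (§3; kit j145657 plan A/B)
of the reducible reference rows `9702g1` (nonsplit) and `90a1` (split) at tower levels `n = 1, …, 4`, every projection `(m, ε)`: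
the `m ≥ 1` projections are ONE list for both classes — `n=1: 0/−1; n=2: (1,±) −2/−1 (2,±) −2/−1; n=3: −2/−3, −4/−5, −4/−5;
n=4: −4/−3, −8/−7, −14/−13, −14/−13` — and the bottoms are `hhBottom` (nonsplit: `0/0, 0/−1, −1/−1, −1/−2`) resp. the irr bottoms
(split: `0/−1, −1/−1, −1/−2, −2/−2`). Caps are data of L2 / clause (i) and are omitted. -/
theorem redProfile_matches_table :
    (List.map (fun c : ℕ × ℕ × Bool => rampRed c.1 c.2.1 c.2.2)
      [(1,1,true), (1,1,false),
       (2,1,true), (2,1,false), (2,2,true), (2,2,false),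
       (3,1,true), (3,1,false), (3,2,true), (3,2,false), (3,3,true), (3,3,false),
       (4,1,true), (4,1,false), (4,2,true), (4,2,false), (4,3,true), (4,3,false), (4,4,true), (4,4,false)]
      = [0, -1,  -2, -1, -2, -1,  -2, -3, -4, -5, -4, -5,  -4, -3, -8, -7, -14, -13, -14, -13]) ∧
    (List.map (fun n => (hhBottom n true, hhBottom n false)) [1, 2, 3, 4] = [(0, 0), (0, -1), (-1, -1), (-1, -2)]) ∧
    (List.map (fun n : ℕ => (-((n / 2 : ℕ) : ℤ), -(((n + 1) / 2 : ℕ) : ℤ))) [1, 2, 3, 4] = [(0, -1), (-1, -1), (-1, -2), (-2, -2)]) := by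
  decide

end Summit.BirchSwinnertonDyer.Rank1Residual.O5
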